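import Summits.BirchSwinnertonDyer.BirchSwinnertonDyer.Theorems.SignedBaseChangeAnticyclotomicEisensteinDivisibilityPrimaryTorsionCofree
import Literature.NumberTheory.IwasawaTheory.PruferPontryaginDual
import HarnessLib

/-!
# A TATE DUAL `Hom(E[p^∞], K̄ˣ)` of `E[p^∞]` with a finite `ℤ_p`-basis (second half of the registered
# stub `stub_primaryTorsionCofreeSS` of line `bdpline`, crux `AnticyclotomicEisensteinDivisibility`,
# stmt-BirchSwinnertonDyer-20727; the hypothesis `hTate` of
# `SignedBaseChangeAcDivAssembly.fullAtSelmer_isAlmostDivisible_curve`), and the stub ASSEMBLED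

Lead seat bsd-line-sbc-p1 gen 3 (2026-08-28); sequel of `…PrimaryTorsionCofree.lean` (`E[p^∞]` is
`ℤ_p`-cofree: `Hom(E[p^∞], ℚ/ℤ)` finite free). Prüfer duality (tree
`Literature/NumberTheory/IwasawaTheory/PruferPontryaginDual.lean`: injective characters
`ℚ_p/ℤ_p → ℚ/ℤ`, `ℚ_p/ℤ_p → K̄ˣ`, and the `p^n`-torsion bounds of `ℚ/ℤ` and `K̄ˣ`) identifies
`Hom(E[p^∞], K̄ˣ) = Hom(E[p^∞], μ_{p^∞})` with `Hom(E[p^∞], ℚ/ℤ)`: every additive map out of the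
`p`-primary `E[p^∞]` into `ℚ/ℤ` or `K̄ˣ` factors uniquely through the chosen copy of `ℚ_p/ℤ_p`
(`exists_eq_apply_of_pow_smul_eq_zero`, `exists_comp_eq`). Transporting along this identification:

* `exists_tateDual_basis` — `∃ Y tA, IsDualPairing ℤ_p E[p^∞] tA ∧ Y has a Fin n basis` with
  `Y = Hom(E[p^∞], ℚ/ℤ)` and `tA χ = j_U ∘ j_Q⁻¹ ∘ χ`;
* `primaryTorsionCofree_and_tateDual` — the conjunction = the registered stub's body at `(K, W, p)`;
  the stub itself (with its `∀ K W p` telescope) is `stub_primaryTorsionCofreeSS`.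

Theorems only (no definition, no named fact, no `sorry`); route-independent. BSD is not proved by
any of this.

References: J. H. Silverman, *AEC* (2009), III.§7–§8 (`E[p^∞]`, Weil pairing currency `μ_{p^∞}`);
R. Greenberg, *On the structure of Selmer groups* (2016), §2 p. 5 (`T* = Hom(D, μ_{p^∞})`);
H. Hida, *Modular Forms and Galois Cohomology* (2000), §3.2.
-/

-- D-0017: single-problem summit, the namespace repeats the problem name by design.
set_option linter.dupNamespace false
set_option autoImplicit false

noncomputable section

open scoped Classical

open Literature.NumberTheory.EllipticCurves Literature.NumberTheory.IwasawaTheory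
  Literature.NumberTheory.IwasawaTheory.Greenberg2016 Literature.NumberTheory.GaloisRepresentations

namespace Summit.BirchSwinnertonDyer.BirchSwinnertonDyer.Theorems.SignedBaseChangeAcDivPrimaryTorsionCofree

/-! ## §1 Prüfer range lemma: `p`-power torsion of `C` lies in the image of an injective `ℚ_p/ℤ_p → C` -/

section Range

variable {p : ℕ} [Fact p.Prime] {C : Type*} [AddCommGroup C]

/-- **Counting**: if `j : ℚ_p/ℤ_p → C` is injective and the `p^n`-torsion subsets of `C` have at most
`p^n` elements, then every `x ∈ C` with `p^n x = 0` is `j(k · t_n)` for some `k` (the `p^n` elements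
`j(k · t_n)`, `k < p^n`, exhaust the `p^n`-torsion). The tree's `exists_apply_tgen_eq` with `φ(t_n)`
replaced by an arbitrary torsion element. [cite: Hida2000, §3.2 (proof preceding Cor. 3.19)] -/
theorem exists_eq_apply_of_pow_smul_eq_zero {j : QpModZp p →+ C} (hj : Function.Injective j)
    (hC : ∀ (n : ℕ) (s : Finset C), (∀ c ∈ s, p ^ n • c = 0) → s.card ≤ p ^ n)
    {x : C} {n : ℕ} (hx : p ^ n • x = 0) : ∃ q : QpModZp p, x = j q := by
  let f : ℕ → C := fun k ↦ j ((k : ℤ_[p]) • QpModZp.tgen p n)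
  let s : Finset C := (Finset.range (p ^ n)).image f
  have hinj : Set.InjOn f (Finset.range (p ^ n) : Set ℕ) := by
    intro k hk k' hk' hkk'
    have h1 := QpModZp.natCast_eq_natCast_of_smul_tgen_eq (hj hkk')
    rw [ZMod.natCast_eq_natCast_iff', Nat.mod_eq_of_lt (Finset.mem_range.mp hk),
      Nat.mod_eq_of_lt (Finset.mem_range.mp hk')] at h1
    exact h1
  have hcard : s.card = p ^ n := by
    rw [Finset.card_image_of_injOn hinj, Finset.card_range]
  have htors : ∀ c ∈ insert x s, p ^ n • c = 0 := by
    intro c hc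
    rcases Finset.mem_insert.mp hc with rfl | hc
    · exact hx
    · obtain ⟨k, -, rfl⟩ := Finset.mem_image.mp hc
      change p ^ n • j ((k : ℤ_[p]) • QpModZp.tgen p n) = 0
      rw [← map_nsmul, smul_comm, QpModZp.pow_nsmul_tgen, smul_zero, map_zero]
  by_contra hne
  have hnot : x ∉ s := fun hmem ↦ by
    obtain ⟨k, -, hk⟩ := Finset.mem_image.mp hmem
    exact hne ⟨_, hk.symm⟩
  have := hC n _ htors
  rw [Finset.card_insert_of_notMem hnot, hcard] at this
  omega

/-- Lifts along an injective map are unique: `j ∘ ψ = j ∘ ψ' ⟹ ψ = ψ'`. [folklore] -/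
theorem comp_cancel {S : Type*} [AddCommGroup S] {j : QpModZp p →+ C} (hj : Function.Injective j)
    {ψ ψ' : S →+ QpModZp p} (h : j.comp ψ = j.comp ψ') : ψ = ψ' := by
  ext s
  exact hj (DFunLike.congr_fun h s)

end Range

/-! ## §2 Every additive map `E[p^∞] → C` factors through the chosen `ℚ_p/ℤ_p ⊂ C` -/

section Curve

variable {K : Type} [Field K] (W : WeierstrassCurve K) [W.IsElliptic] (p : ℕ) [Fact p.Prime]

omit [W.IsElliptic] in
/-- **Factorisation through `ℚ_p/ℤ_p`**: for `j : ℚ_p/ℤ_p → C` injective with the `p^n`-torsion bound,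
every additive `φ : E[p^∞] → C` is `j ∘ ψ` for a (unique) additive `ψ : E[p^∞] → ℚ_p/ℤ_p` (values of
`φ` are `p`-power torsion, §1; additivity of the lift from injectivity of `j`).
[cite: Hida2000, §3.2] [cite: SilvermanAEC2009, III.§7] -/
theorem exists_comp_eq {C : Type*} [AddCommGroup C] {j : QpModZp p →+ C} (hj : Function.Injective j)
    (hC : ∀ (n : ℕ) (s : Finset C), (∀ c ∈ s, p ^ n • c = 0) → s.card ≤ p ^ n)
    (φ : PrimaryTorsion W.geomPoints p →+ C) :
    ∃ ψ : PrimaryTorsion W.geomPoints p →+ QpModZp p, j.comp ψ = φ := by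
  have hex : ∀ s : PrimaryTorsion W.geomPoints p, ∃ q : QpModZp p, φ s = j q := fun s ↦ by
    obtain ⟨k, hk⟩ := s.exists_pow_smul_eq_zero
    have hs : p ^ k • s = 0 :=
      PrimaryTorsion.ext (by rw [PrimaryTorsion.val_nsmul, hk, PrimaryTorsion.val_zero])
    exact exists_eq_apply_of_pow_smul_eq_zero hj hC (n := k) (by rw [← map_nsmul, hs, map_zero])
  choose q hq using hex
  refine ⟨{ toFun := q, map_zero' := ?_, map_add' := fun a b ↦ ?_ }, ?_⟩
  · apply hj
    rw [← hq, map_zero, map_zero]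
  · apply hj
    rw [← hq, map_add, map_add, ← hq, ← hq]
  · ext s
    exact (hq s).symm

variable [NumberField K]

/-- **A Tate dual `Hom(E[p^∞], K̄ˣ)` of `E[p^∞]` with a finite `ℤ_p`-basis** (hypothesis `hTate` of
`SignedBaseChangeAcDivAssembly.fullAtSelmer_isAlmostDivisible_curve`): `Y = Hom(E[p^∞], ℚ/ℤ)` (finite
free, `…PrimaryTorsionCofree`), `tA χ = j_U ∘ ψ_χ` where `j_Q ∘ ψ_χ = χ` (Prüfer: both `ℚ/ℤ` and `K̄ˣ`
contain a copy of `ℚ_p/ℤ_p` carrying all their `p`-power torsion); `tA` is a bijection onto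
`Hom(E[p^∞], K̄ˣ)` and `ℤ_p`-balanced. [cite: Greenberg2016Selmer, §2 p. 5 (`T* = Hom(D, μ_{p^∞})` free)]
[cite: Hida2000, §3.2] -/
theorem exists_tateDual_basis :
    ∃ (Y : Type) (_ : AddCommGroup Y) (_ : Module ℤ_[p] Y)
      (tA : Y →+ (PrimaryTorsion W.geomPoints p →+ DiscreteGaloisModule.UnitsCarrier K))
      (_ : IsDualPairing ℤ_[p] (PrimaryTorsion W.geomPoints p) tA) (n : ℕ),
      Nonempty (Module.Basis (Fin n) ℤ_[p] Y) := by
  classical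
  set S := PrimaryTorsion W.geomPoints p
  obtain ⟨jQ, hjQ⟩ := QpModZp.exists_injective_character (p := p)
  obtain ⟨jU, hjU, -, -⟩ :=
    QpModZp.exists_unitsCarrier_hinj_hsurj_of_linearEquiv K (LinearEquiv.refl ℤ_[p] (QpModZp p))
  have hCQ : ∀ (n : ℕ) (s : Finset (AddCircle (1 : ℚ))), (∀ c ∈ s, p ^ n • c = 0) → s.card ≤ p ^ n :=
    fun n s hs ↦ QpModZp.addCircle_torsionBound n s hs
  have hCU : ∀ (n : ℕ) (s : Finset (DiscreteGaloisModule.UnitsCarrier K)),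
      (∀ c ∈ s, p ^ n • c = 0) → s.card ≤ p ^ n :=
    fun n s hs ↦ QpModZp.unitsCarrier_torsionBound K n s hs
  -- the lifts through `ℚ_p/ℤ_p`
  have hQ : ∀ χ : CharacterModule S, ∃ ψ : S →+ QpModZp p, jQ.comp ψ = χ :=
    fun χ ↦ exists_comp_eq W p hjQ hCQ χ
  choose liftQ hliftQ using hQ
  have hU : ∀ f : S →+ DiscreteGaloisModule.UnitsCarrier K, ∃ ψ : S →+ QpModZp p, jU.comp ψ = f :=
    fun f ↦ exists_comp_eq W p hjU hCU f
  choose liftU hliftU using hU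
  have hliftQ_add : ∀ χ χ' : CharacterModule S, liftQ (χ + χ') = liftQ χ + liftQ χ' := fun χ χ' ↦
    comp_cancel hjQ (by rw [hliftQ, AddMonoidHom.comp_add, hliftQ, hliftQ]; exact rfl)
  have hliftQ_zero : liftQ 0 = 0 := comp_cancel hjQ (by rw [hliftQ, AddMonoidHom.comp_zero]; exact rfl)
  -- the Tate dual datum
  let tA : CharacterModule S →+ (S →+ DiscreteGaloisModule.UnitsCarrier K) :=
    { toFun := fun χ ↦ jU.comp (liftQ χ)
      map_zero' := by simp only [hliftQ_zero, AddMonoidHom.comp_zero]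
      map_add' := fun χ χ' ↦ by simp only [hliftQ_add, AddMonoidHom.comp_add] }
  have htA : ∀ χ : CharacterModule S, tA χ = jU.comp (liftQ χ) := fun _ ↦ rfl
  have hpair : IsDualPairing ℤ_[p] S tA := by
    refine ⟨⟨fun χ χ' h ↦ ?_, fun f ↦ ⟨jQ.comp (liftU f), ?_⟩⟩, fun c χ s ↦ ?_⟩
    · -- injective
      have h1 : liftQ χ = liftQ χ' := comp_cancel hjU (by rw [← htA, ← htA, h])
      rw [← hliftQ χ, ← hliftQ χ', h1]
    · -- surjective
      have h1 : liftQ (jQ.comp (liftU f)) = liftU f := comp_cancel hjQ (by rw [hliftQ])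
      rw [htA, h1, hliftU]
    · -- balanced
      rw [htA, htA, AddMonoidHom.comp_apply, AddMonoidHom.comp_apply]
      congr 1
      apply hjQ
      have e1 := DFunLike.congr_fun (hliftQ (c • χ)) s
      have e2 := DFunLike.congr_fun (hliftQ χ) (c • s)
      rw [AddMonoidHom.comp_apply] at e1 e2
      rw [e1, e2]
      exact CharacterModule.smul_apply χ c s
  haveI := module_free_characterModule W p
  haveI := module_finite_characterModule W p
  let b := Module.Free.chooseBasis ℤ_[p] (CharacterModule S)
  exact ⟨CharacterModule S, inferInstance, inferInstance, tA, hpair, _,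
    ⟨b.reindex (Fintype.equivFin _)⟩⟩

/-- **The registered stub's body at `(K, W, p)`**: `E[p^∞]` is `ℤ_p`-cofree AND has a Tate dual with a
finite basis. [cite: Greenberg2016Selmer, §2 p. 5, §4.1 Prop. 4.1.1 (b)] [cite: SilvermanAEC2009, III.§7] -/
theorem primaryTorsionCofree_and_tateDual :
    IsCofree ℤ_[p] (PrimaryTorsion W.geomPoints p) ∧
      ∃ (Y : Type) (_ : AddCommGroup Y) (_ : Module ℤ_[p] Y)
        (tA : Y →+ (PrimaryTorsion W.geomPoints p →+ DiscreteGaloisModule.UnitsCarrier K))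
        (_ : IsDualPairing ℤ_[p] (PrimaryTorsion W.geomPoints p) tA) (n : ℕ),
        Nonempty (Module.Basis (Fin n) ℤ_[p] Y) :=
  ⟨isCofree_primaryTorsion W p, exists_tateDual_basis W p⟩

end Curve

/-! ## §3 The registered stub of line `bdpline` (v19), verbatim -/

/-- **Stub (R1a) `stub_primaryTorsionCofreeSS` of line `bdpline` (v19), PROVED** — for every elliptic
curve over a number field and every prime: `E[p^∞]` is a cofree `ℤ_p`-module and some Tate dual
`Hom(E[p^∞], K̄ˣ)` has a finite `ℤ_p`-basis. [cite: Greenberg2016Selmer, §2 p. 5, §4.1 Prop. 4.1.1 (b)]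
[cite: SilvermanAEC2009, III.§7] -/
theorem stub_primaryTorsionCofreeSS :
    ∀ (K : Type) [Field K] [NumberField K] (W : WeierstrassCurve K) [W.IsElliptic] (p : ℕ) [Fact p.Prime], Literature.NumberTheory.IwasawaTheory.Greenberg2016.IsCofree ℤ_[p] (Literature.NumberTheory.EllipticCurves.PrimaryTorsion W.geomPoints p) ∧ ∃ (Y : Type) (_ : AddCommGroup Y) (_ : Module ℤ_[p] Y) (tA : Y →+ (Literature.NumberTheory.EllipticCurves.PrimaryTorsion W.geomPoints p →+ Literature.NumberTheory.GaloisRepresentations.DiscreteGaloisModule.UnitsCarrier K)) (_ : Literature.NumberTheory.IwasawaTheory.Greenberg2016.IsDualPairing ℤ_[p] (Literature.NumberTheory.EllipticCurves.PrimaryTorsion W.geomPoints p) tA) (n : ℕ), Nonempty (Module.Basis (Fin n) ℤ_[p] Y) :=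
  fun _ _ _ W _ p _ ↦ primaryTorsionCofree_and_tateDual W p

end Summit.BirchSwinnertonDyer.BirchSwinnertonDyer.Theorems.SignedBaseChangeAcDivPrimaryTorsionCofree

end
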